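import Summits.MatrixMultiplication.MatrixMultiplication.Theorems.FarEdgeDescentIsolatedSquare
import Summits.MatrixMultiplication.MatrixMultiplication.Theorems.FarEdgeDescentTowerChain
import HarnessLib

/-!
# Far-edge descent, kernel XXXII-C: the IMPROVABLE squaring tower as a certified numeric chain

Route `FarEdgeDescent`, special leaf `FiniteSaturation` (stmt-MatrixMultiplication-23739): helper
kernel, THESES-FREE and def-free.  Kernel XXXI-B (`FarEdgeDescentImprovableRate.rateBeyond_of_improvableChain`)
proved `RateBeyond θ` for every `θ < log(4/3)/log(3/2) = 0.70951…` GIVEN a numeric chain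
`(r_j, Q_j, L_j, G_j)` of the improvable squaring tower (`r' = r²`, `L' = (Q+L)² − Q²`, `Q + 2L = r`,
`G' = (Q^t + G)² − Q^{2t}`) whose virtual readout `G_j(s,t) ≤ r_j` holds on every sub-tangent of
`y ↦ ω(1,y,1)`.  This file CONSTRUCTS such a chain from any certified start, every stage realised by an
actual approximate algorithm with an ISOLATED ANCHOR (kernels XXXII-A/B), exporting only the numbers —
the improvable analogue of kernel XXX-A (`FarEdgeDescentTowerChain.crudeTowerChain`):

* §1 `chain_exists` — the clock-`2` improvable recursion on `(r, Q, L, G)` (primitive recursion).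
* §2 counting over the kept PAIRS of an anchored family `⟨1,q,1⟩ ⊕ ⊕ᵢ⟨aᵢ,Bᵢ,aᵢ⟩`: legs
  `∑_{kept}(a a')(B B') = (q + ∑aB)² − q²` and virtual values `(q^t + ∑a^sB^t)² − q^{2t}`
  (`sum_pairDrop_add` of kernel XXXII-B).
* §3 `isolatedTowerChain` — from an isolated-anchor realization of `⟨1,Q₀,1⟩ ⊕ ⊕ᵢ⟨aᵢ,Bᵢ,aᵢ⟩` of length
  `r₀ = Q₀ + 2∑aᵢBᵢ` (`aᵢ ≥ 2`, `Bᵢ ≥ 1`, `Q₀ ≥ 1`): sequences with `Q_j + 2L_j = r_j`, `Q_j ≥ 1`,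
  `r' = r²`, `L' = (Q+L)² − Q²`, `G' = (Q^t+G)² − Q^{2t}` and the readout `G_j(s,t) ≤ r_j` at every
  sub-tangent (kernel XXVIII `virtualSum_le_algBorderRank` on the non-anchor blocks, `bR ≤ r_j` by the
  stage-`j` realization).  The stage step is `isolated_stage` (square, delete the anchor pair, re-anchor
  at `q' = r² − 2L'` COST-FREE; `2L' ≤ r²` because `r = Q + 2L`).
Kernel XXXII-D starts it at Schönhage's `E₃ = ⟨3,1,3⟩ ⊕ ⟨1,4,1⟩` (`r₀ = 10`) and concludes the
unconditional rate `0.70951…⁻`.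

References: Pan 1984 (LNCS 179) §16 (Props. 16.2–16.5), §17 Thm. 17.1; Stothers 2010, Def. 8, Thm. 8;
Knuth TAOCP 2, §4.6.4 Ex. 67(g),(h); Lotti–Romani 1983, Prop. 4.1; Coppersmith–Winograd 1982.
Tags: `FiniteSaturation` (h₁) NEC · WEAKER (the chain of kernel XXXI-B, constructed).
-/

set_option linter.dupNamespace false

noncomputable section

open scoped BigOperators Polynomial
open Polynomial

namespace Summit.MatrixMultiplication.MatrixMultiplication.Theorems.FarEdgeDescentIsolatedChain

open Literature.Computability.AlgebraicComplexity
open Summit.MatrixMultiplication.MatrixMultiplication.Theorems.FarEdgeDescentVirtualAdditivity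
open Summit.MatrixMultiplication.MatrixMultiplication.Theorems.FarEdgeDescentTowerChain
open Summit.MatrixMultiplication.MatrixMultiplication.Theorems.FarEdgeDescentIsolatedStep
open Summit.MatrixMultiplication.MatrixMultiplication.Theorems.FarEdgeDescentIsolatedSquare

variable (K : Type) [Field K]

/-! ## §1 The improvable numeric recursion (constructed, not defined) -/

/-- **The clock-`2` improvable recursion exists** (primitive recursion on a quadruple):
`L' = (Q+L)² − Q²`, `r' = r²`, `Q' = r² − 2L'`, `G'(s,t) = (Q^t + G(s,t))² − (Q^t)²`. [folklore] -/
theorem chain_exists (r₀ Q₀ L₀ : ℕ) (G₀ : ℝ → ℝ → ℝ) :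
    ∃ (r Q L : ℕ → ℕ) (G : ℕ → ℝ → ℝ → ℝ),
      r 0 = r₀ ∧ Q 0 = Q₀ ∧ L 0 = L₀ ∧ G 0 = G₀ ∧
      (∀ j, L (j + 1) = (Q j + L j) ^ 2 - Q j ^ 2) ∧
      (∀ j, r (j + 1) = r j ^ 2) ∧
      (∀ j, Q (j + 1) = r j ^ 2 - 2 * L (j + 1)) ∧
      (∀ j (s t : ℝ), G (j + 1) s t =
        (((Q j : ℕ) : ℝ) ^ t + G j s t) ^ 2 - (((Q j : ℕ) : ℝ) ^ t) ^ 2) := by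
  let step : (ℕ × ℕ × ℕ) × (ℝ → ℝ → ℝ) → (ℕ × ℕ × ℕ) × (ℝ → ℝ → ℝ) := fun x =>
    ((x.1.1 ^ 2,
      x.1.1 ^ 2 - 2 * ((x.1.2.1 + x.1.2.2) ^ 2 - x.1.2.1 ^ 2),
      (x.1.2.1 + x.1.2.2) ^ 2 - x.1.2.1 ^ 2),
      fun s t => (((x.1.2.1 : ℕ) : ℝ) ^ t + x.2 s t) ^ 2 - (((x.1.2.1 : ℕ) : ℝ) ^ t) ^ 2)
  let U : ℕ → (ℕ × ℕ × ℕ) × (ℝ → ℝ → ℝ) := fun j =>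
    Nat.rec (motive := fun _ => (ℕ × ℕ × ℕ) × (ℝ → ℝ → ℝ)) ((r₀, Q₀, L₀), G₀) (fun _ x => step x) j
  have hU : ∀ j, U (j + 1) = step (U j) := fun j => rfl
  refine ⟨fun j => (U j).1.1, fun j => (U j).1.2.1, fun j => (U j).1.2.2, fun j => (U j).2,
    rfl, rfl, rfl, rfl, fun j => ?_, fun j => ?_, fun j => ?_, fun j s t => ?_⟩ <;>
  simp only [hU, step]

/-! ## §2 Counting over the kept pairs of an anchored family -/

section Anchored

variable {p : ℕ} (a B : Fin p → ℕ) (q : ℕ) {M : ℕ} (hM : (p + 1) * (p + 1) = M + 1)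

/-- **Legs of the kept pairs**: `∑_{kept} (a a')(B B') = (q + ∑ aB)² − q²`. [folklore] -/
theorem keptPairLegs_eq :
    (∑ w : Fin M,
        ((Fin.cons 1 a : Fin (p + 1) → ℕ) (finProdFinEquiv.symm (Fin.cast hM.symm
            ((Fin.cast hM (finProdFinEquiv ((0 : Fin (p + 1)), (0 : Fin (p + 1))))).succAbove w))).1 *
          (Fin.cons 1 a : Fin (p + 1) → ℕ) (finProdFinEquiv.symm (Fin.cast hM.symm
            ((Fin.cast hM (finProdFinEquiv ((0 : Fin (p + 1)), (0 : Fin (p + 1))))).succAbove w))).2) *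
        ((Fin.cons q B : Fin (p + 1) → ℕ) (finProdFinEquiv.symm (Fin.cast hM.symm
            ((Fin.cast hM (finProdFinEquiv ((0 : Fin (p + 1)), (0 : Fin (p + 1))))).succAbove w))).1 *
          (Fin.cons q B : Fin (p + 1) → ℕ) (finProdFinEquiv.symm (Fin.cast hM.symm
            ((Fin.cast hM (finProdFinEquiv ((0 : Fin (p + 1)), (0 : Fin (p + 1))))).succAbove w))).2)) =
      (q + ∑ i, a i * B i) ^ 2 - q ^ 2 := by
  have h := sum_pairDrop_add
    (f := fun i : Fin (p + 1) => (Fin.cons 1 a : Fin (p + 1) → ℕ) i * (Fin.cons q B : Fin (p + 1) → ℕ) i)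
    hM (0 : Fin (p + 1))
  simp only [Fin.cons_zero, one_mul, Fin.sum_univ_succ, Fin.cons_succ] at h
  have h' : (∑ w : Fin M,
        ((Fin.cons 1 a : Fin (p + 1) → ℕ) (finProdFinEquiv.symm (Fin.cast hM.symm
            ((Fin.cast hM (finProdFinEquiv ((0 : Fin (p + 1)), (0 : Fin (p + 1))))).succAbove w))).1 *
          (Fin.cons 1 a : Fin (p + 1) → ℕ) (finProdFinEquiv.symm (Fin.cast hM.symm
            ((Fin.cast hM (finProdFinEquiv ((0 : Fin (p + 1)), (0 : Fin (p + 1))))).succAbove w))).2) *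
        ((Fin.cons q B : Fin (p + 1) → ℕ) (finProdFinEquiv.symm (Fin.cast hM.symm
            ((Fin.cast hM (finProdFinEquiv ((0 : Fin (p + 1)), (0 : Fin (p + 1))))).succAbove w))).1 *
          (Fin.cons q B : Fin (p + 1) → ℕ) (finProdFinEquiv.symm (Fin.cast hM.symm
            ((Fin.cast hM (finProdFinEquiv ((0 : Fin (p + 1)), (0 : Fin (p + 1))))).succAbove w))).2)) =
      ∑ w : Fin M,
        (Fin.cons 1 a : Fin (p + 1) → ℕ) (finProdFinEquiv.symm (Fin.cast hM.symm
            ((Fin.cast hM (finProdFinEquiv ((0 : Fin (p + 1)), (0 : Fin (p + 1))))).succAbove w))).1 *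
          (Fin.cons q B : Fin (p + 1) → ℕ) (finProdFinEquiv.symm (Fin.cast hM.symm
            ((Fin.cast hM (finProdFinEquiv ((0 : Fin (p + 1)), (0 : Fin (p + 1))))).succAbove w))).1 *
        ((Fin.cons 1 a : Fin (p + 1) → ℕ) (finProdFinEquiv.symm (Fin.cast hM.symm
            ((Fin.cast hM (finProdFinEquiv ((0 : Fin (p + 1)), (0 : Fin (p + 1))))).succAbove w))).2 *
          (Fin.cons q B : Fin (p + 1) → ℕ) (finProdFinEquiv.symm (Fin.cast hM.symm
            ((Fin.cast hM (finProdFinEquiv ((0 : Fin (p + 1)), (0 : Fin (p + 1))))).succAbove w))).2) :=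
    Finset.sum_congr rfl fun w _ => by ring
  rw [h']
  have hq2 : q ^ 2 = q * q := sq q
  have hS2 : (q + ∑ i, a i * B i) ^ 2 = q * q + ∑ w : Fin M,
        (Fin.cons 1 a : Fin (p + 1) → ℕ) (finProdFinEquiv.symm (Fin.cast hM.symm
            ((Fin.cast hM (finProdFinEquiv ((0 : Fin (p + 1)), (0 : Fin (p + 1))))).succAbove w))).1 *
          (Fin.cons q B : Fin (p + 1) → ℕ) (finProdFinEquiv.symm (Fin.cast hM.symm
            ((Fin.cast hM (finProdFinEquiv ((0 : Fin (p + 1)), (0 : Fin (p + 1))))).succAbove w))).1 *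
        ((Fin.cons 1 a : Fin (p + 1) → ℕ) (finProdFinEquiv.symm (Fin.cast hM.symm
            ((Fin.cast hM (finProdFinEquiv ((0 : Fin (p + 1)), (0 : Fin (p + 1))))).succAbove w))).2 *
          (Fin.cons q B : Fin (p + 1) → ℕ) (finProdFinEquiv.symm (Fin.cast hM.symm
            ((Fin.cast hM (finProdFinEquiv ((0 : Fin (p + 1)), (0 : Fin (p + 1))))).succAbove w))).2) :=
    h.symm
  omega

/-- **Virtual census of the kept pairs**: `∑_{kept} (a a')^s (B B')^t = (q^t + ∑ a^s B^t)² − (q^t)²`.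
[folklore] -/
theorem keptPairVirtual_eq (s t : ℝ) :
    (∑ w : Fin M,
        ((((Fin.cons 1 a : Fin (p + 1) → ℕ) (finProdFinEquiv.symm (Fin.cast hM.symm
            ((Fin.cast hM (finProdFinEquiv ((0 : Fin (p + 1)), (0 : Fin (p + 1))))).succAbove w))).1 *
          (Fin.cons 1 a : Fin (p + 1) → ℕ) (finProdFinEquiv.symm (Fin.cast hM.symm
            ((Fin.cast hM (finProdFinEquiv ((0 : Fin (p + 1)), (0 : Fin (p + 1))))).succAbove w))).2 : ℕ) : ℝ)) ^ s *
        ((((Fin.cons q B : Fin (p + 1) → ℕ) (finProdFinEquiv.symm (Fin.cast hM.symm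
            ((Fin.cast hM (finProdFinEquiv ((0 : Fin (p + 1)), (0 : Fin (p + 1))))).succAbove w))).1 *
          (Fin.cons q B : Fin (p + 1) → ℕ) (finProdFinEquiv.symm (Fin.cast hM.symm
            ((Fin.cast hM (finProdFinEquiv ((0 : Fin (p + 1)), (0 : Fin (p + 1))))).succAbove w))).2 : ℕ) : ℝ)) ^ t) =
      (((q : ℕ) : ℝ) ^ t + ∑ i, ((a i : ℕ) : ℝ) ^ s * ((B i : ℕ) : ℝ) ^ t) ^ 2 - (((q : ℕ) : ℝ) ^ t) ^ 2 := by
  have h := sum_pairDrop_add (S := ℝ)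
    (f := fun i : Fin (p + 1) =>
      (((Fin.cons 1 a : Fin (p + 1) → ℕ) i : ℕ) : ℝ) ^ s * (((Fin.cons q B : Fin (p + 1) → ℕ) i : ℕ) : ℝ) ^ t)
    hM (0 : Fin (p + 1))
  simp only [Fin.cons_zero, Nat.cast_one, Real.one_rpow, one_mul, Fin.sum_univ_succ, Fin.cons_succ] at h
  have hw : ∀ w : Fin M,
      ((((Fin.cons 1 a : Fin (p + 1) → ℕ) (finProdFinEquiv.symm (Fin.cast hM.symm
            ((Fin.cast hM (finProdFinEquiv ((0 : Fin (p + 1)), (0 : Fin (p + 1))))).succAbove w))).1 *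
          (Fin.cons 1 a : Fin (p + 1) → ℕ) (finProdFinEquiv.symm (Fin.cast hM.symm
            ((Fin.cast hM (finProdFinEquiv ((0 : Fin (p + 1)), (0 : Fin (p + 1))))).succAbove w))).2 : ℕ) : ℝ)) ^ s *
        ((((Fin.cons q B : Fin (p + 1) → ℕ) (finProdFinEquiv.symm (Fin.cast hM.symm
            ((Fin.cast hM (finProdFinEquiv ((0 : Fin (p + 1)), (0 : Fin (p + 1))))).succAbove w))).1 *
          (Fin.cons q B : Fin (p + 1) → ℕ) (finProdFinEquiv.symm (Fin.cast hM.symm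
            ((Fin.cast hM (finProdFinEquiv ((0 : Fin (p + 1)), (0 : Fin (p + 1))))).succAbove w))).2 : ℕ) : ℝ)) ^ t =
      ((((Fin.cons 1 a : Fin (p + 1) → ℕ) (finProdFinEquiv.symm (Fin.cast hM.symm
            ((Fin.cast hM (finProdFinEquiv ((0 : Fin (p + 1)), (0 : Fin (p + 1))))).succAbove w))).1 : ℕ) : ℝ) ^ s *
        (((Fin.cons q B : Fin (p + 1) → ℕ) (finProdFinEquiv.symm (Fin.cast hM.symm
            ((Fin.cast hM (finProdFinEquiv ((0 : Fin (p + 1)), (0 : Fin (p + 1))))).succAbove w))).1 : ℕ) : ℝ) ^ t) *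
      ((((Fin.cons 1 a : Fin (p + 1) → ℕ) (finProdFinEquiv.symm (Fin.cast hM.symm
            ((Fin.cast hM (finProdFinEquiv ((0 : Fin (p + 1)), (0 : Fin (p + 1))))).succAbove w))).2 : ℕ) : ℝ) ^ s *
        (((Fin.cons q B : Fin (p + 1) → ℕ) (finProdFinEquiv.symm (Fin.cast hM.symm
            ((Fin.cast hM (finProdFinEquiv ((0 : Fin (p + 1)), (0 : Fin (p + 1))))).succAbove w))).2 : ℕ) : ℝ) ^ t) := by
    intro w
    rw [Nat.cast_mul, Nat.cast_mul, Real.mul_rpow (Nat.cast_nonneg _) (Nat.cast_nonneg _),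
      Real.mul_rpow (Nat.cast_nonneg _) (Nat.cast_nonneg _)]
    ring
  rw [Finset.sum_congr rfl (fun w _ => hw w), ← h]
  ring

end Anchored

/-! ## §3 The chain -/

/-- **THE ARITHMETISED IMPROVABLE SQUARING TOWER** (Pan 1984 §16; Stothers 2010, Thm. 8).  From an
approximate realization of `⟨1,Q₀,1⟩ ⊕ ⊕ᵢ⟨aᵢ,Bᵢ,aᵢ⟩` (`aᵢ ≥ 2`, `Bᵢ ≥ 1`, `Q₀ ≥ 1`) of length
`r₀ = Q₀ + 2∑ᵢaᵢBᵢ` in which the anchor block `0` is ISOLATED (kernel XXXII-A's invariant): sequences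
`r, Q, L, G` with the stated initial values and the clock-`2` improvable recursion — `Q_j + 2L_j = r_j`,
`Q_j ≥ 1`, `L' = (Q+L)² − Q²`, `r' = r²`, `G'(s,t) = (Q^t + G(s,t))² − (Q^t)²` — and the virtual readout
`G_j(s,t) ≤ r_j` at every sub-tangent `(s,t)` of `ω(1,·,1)`, every stage realised by an actual
isolated-anchor approximate algorithm (kernel XXXII-B `isolated_stage`), only the numbers exported.
[cite: Pan1984, Props. 16.2–16.5] [cite: Stothers2010, §1, Thm. 8] [cite: KnuthTAOCP2, §4.6.4, Ex. 67(g),(h)] -/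
theorem isolatedTowerChain {p₀ : ℕ} (a₀ B₀ : Fin p₀ → ℕ) (ha₀ : ∀ i, 2 ≤ a₀ i) (hB₀ : ∀ i, 1 ≤ B₀ i)
    {Q₀ r₀ h₀ : ℕ} (hQ₀ : 1 ≤ Q₀) (hsum₀ : Q₀ + 2 * ∑ i, a₀ i * B₀ i = r₀)
    (hinv₀ : ∃ (u : Fin r₀ → _ → K[X]) (v : Fin r₀ → _ → K[X]) (w : Fin r₀ → _ → K[X])
      (d : Fin r₀ → K[X]),
      IsApproxDecomposition h₀ (matMulDirectSum K (Fin.cons 1 a₀) (Fin.cons Q₀ B₀) (Fin.cons 1 a₀))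
        u v w ∧ (∀ s, d s ≠ 0) ∧ ∀ b c, ¬ (b.1 = 0 ∧ c.1 = 0) → ∑ s, d s * v s b * w s c = 0) :
    ∃ (r Q L : ℕ → ℕ) (G : ℕ → ℝ → ℝ → ℝ),
      r 0 = r₀ ∧ Q 0 = Q₀ ∧ L 0 = ∑ i, a₀ i * B₀ i ∧
      (∀ s t : ℝ, G 0 s t = ∑ i, ((a₀ i : ℕ) : ℝ) ^ s * ((B₀ i : ℕ) : ℝ) ^ t) ∧
      (∀ j, Q j + 2 * L j = r j) ∧ (∀ j, 1 ≤ Q j) ∧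
      (∀ j, L (j + 1) = (Q j + L j) ^ 2 - Q j ^ 2) ∧
      (∀ j, r (j + 1) = r j ^ 2) ∧
      (∀ j (s t : ℝ), G (j + 1) s t =
        (((Q j : ℕ) : ℝ) ^ t + G j s t) ^ 2 - (((Q j : ℕ) : ℝ) ^ t) ^ 2) ∧
      (∀ j (s t : ℝ), (∀ y : ℝ, 0 ≤ y → s + y * t ≤ omegaRect K 1 y 1) → G j s t ≤ r j) := by
  classical
  obtain ⟨r, Q, L, G, h0r, h0Q, h0L, h0G, hL, hr, hQ, hG⟩ :=
    chain_exists r₀ Q₀ (∑ i, a₀ i * B₀ i) (fun s t => ∑ i, ((a₀ i : ℕ) : ℝ) ^ s * ((B₀ i : ℕ) : ℝ) ^ t)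
  -- the invariant: stage `j` is realised by an isolated-anchor algorithm with the recorded numbers
  have key : ∀ j, ∃ (p : ℕ) (a B : Fin p → ℕ) (q ϱ : ℕ), q = Q j ∧ ϱ = r j ∧ (∀ i, 2 ≤ a i) ∧
      (∀ i, 1 ≤ B i) ∧ 1 ≤ q ∧ q + 2 * (∑ i, a i * B i) = ϱ ∧ (∑ i, a i * B i) = L j ∧
      (∀ s t : ℝ, (∑ i, ((a i : ℕ) : ℝ) ^ s * ((B i : ℕ) : ℝ) ^ t) = G j s t) ∧
      ∃ (h : ℕ) (u : Fin ϱ → _ → K[X]) (v : Fin ϱ → _ → K[X]) (w : Fin ϱ → _ → K[X])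
        (d : Fin ϱ → K[X]),
        IsApproxDecomposition h (matMulDirectSum K (Fin.cons 1 a) (Fin.cons q B) (Fin.cons 1 a))
          u v w ∧ (∀ s, d s ≠ 0) ∧ ∀ b c, ¬ (b.1 = 0 ∧ c.1 = 0) → ∑ s, d s * v s b * w s c = 0 := by
    intro j
    induction j with
    | zero =>
      exact ⟨p₀, a₀, B₀, Q₀, r₀, h0Q.symm, h0r.symm, ha₀, hB₀, hQ₀, hsum₀, h0L.symm,
        fun s t => by rw [h0G], h₀, hinv₀⟩
    | succ j ih =>
      obtain ⟨p, a, B, q, ϱ, hq, hϱ, ha, hB, hq1, hsum, hLj, hGj, h, hinv⟩ := ih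
      obtain ⟨M, hM⟩ : ∃ M, (p + 1) * (p + 1) = M + 1 :=
        ⟨(p + 1) * (p + 1) - 1, (Nat.succ_pred_eq_of_pos (Nat.mul_pos p.succ_pos p.succ_pos)).symm⟩
      have hφ := pairDrop_injective hM (Fin.cast hM (finProdFinEquiv ((0 : Fin (p + 1)), (0 : Fin (p + 1)))))
      have hφ₀ := pairDrop_ne hM (0 : Fin (p + 1))
      have hlegs := keptPairLegs_eq a B q hM
      -- `2L' ≤ ϱ²` because `ϱ = q + 2L`
      have hexp : (q + ∑ i, a i * B i) ^ 2 - q ^ 2 =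
          2 * q * (∑ i, a i * B i) + (∑ i, a i * B i) ^ 2 := by
        apply Nat.sub_eq_of_eq_add
        ring
      have hϱsq : ϱ * ϱ = 2 * ((q + ∑ i, a i * B i) ^ 2 - q ^ 2) + (q ^ 2 + 2 * (∑ i, a i * B i) ^ 2) := by
        rw [hexp, ← hsum]
        ring
      have h2L : 2 * ((q + ∑ i, a i * B i) ^ 2 - q ^ 2) ≤ ϱ * ϱ := by
        rw [hϱsq]
        exact Nat.le_add_right _ _
      have hq'1 : 1 ≤ ϱ * ϱ - 2 * ((q + ∑ i, a i * B i) ^ 2 - q ^ 2) := by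
        rw [hϱsq, Nat.add_sub_cancel_left]
        nlinarith
      have st := isolated_stage K (Fin.cons 1 a) (Fin.cons q B) (Fin.cons 1 a) hinv _ hφ hφ₀
        (q := ϱ * ϱ - 2 * ((q + ∑ i, a i * B i) ^ 2 - q ^ 2)) (by
          have hY : (∑ w : Fin M,
              ((Fin.cons q B : Fin (p + 1) → ℕ) (finProdFinEquiv.symm (Fin.cast hM.symm
                  ((Fin.cast hM (finProdFinEquiv ((0 : Fin (p + 1)), (0 : Fin (p + 1))))).succAbove w))).1 *
                (Fin.cons q B : Fin (p + 1) → ℕ) (finProdFinEquiv.symm (Fin.cast hM.symm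
                  ((Fin.cast hM (finProdFinEquiv ((0 : Fin (p + 1)), (0 : Fin (p + 1))))).succAbove w))).2) *
              ((Fin.cons 1 a : Fin (p + 1) → ℕ) (finProdFinEquiv.symm (Fin.cast hM.symm
                  ((Fin.cast hM (finProdFinEquiv ((0 : Fin (p + 1)), (0 : Fin (p + 1))))).succAbove w))).1 *
                (Fin.cons 1 a : Fin (p + 1) → ℕ) (finProdFinEquiv.symm (Fin.cast hM.symm
                  ((Fin.cast hM (finProdFinEquiv ((0 : Fin (p + 1)), (0 : Fin (p + 1))))).succAbove w))).2)) =
              (q + ∑ i, a i * B i) ^ 2 - q ^ 2 := by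
            rw [← hlegs]
            exact Finset.sum_congr rfl fun w _ => mul_comm _ _
          rw [hlegs, hY]
          omega)
      refine ⟨M, _, _, ϱ * ϱ - 2 * ((q + ∑ i, a i * B i) ^ 2 - q ^ 2), ϱ * ϱ, ?_, ?_,
        fun w => two_le_mul_of_ne_anchorPair (Fin.cons 1 a) (cons_one_le a ha) (cons_two_le a ha) (hφ₀ w),
        fun w => one_le_mul_of_one_le (Fin.cons q B) (cons_mid_one_le B q hB hq1) _, hq'1, ?_, ?_,
        fun s t => ?_, st⟩
      · -- new anchor = Q (j+1)
        rw [hQ, hL, ← hq, ← hLj, ← hϱ, sq ϱ]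
      · -- new length = r (j+1)
        rw [hr, ← hϱ, sq ϱ]
      · -- tightness `q' + 2L' = r'`
        rw [hlegs]
        omega
      · -- legs
        rw [hlegs, hL, ← hq, ← hLj]
      · -- virtual census
        rw [keptPairVirtual_eq a B q hM s t, hG, hGj, ← hq]
  refine ⟨r, Q, L, G, h0r, h0Q, h0L, fun s t => by rw [h0G], fun j => ?_, fun j => ?_, hL, hr, hG,
    fun j s t hst => ?_⟩
  · obtain ⟨p, a, B, q, ϱ, hq, hϱ, -, -, -, hsum, hLj, -⟩ := key j
    rw [← hq, ← hϱ, ← hLj]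
    exact hsum
  · obtain ⟨p, a, B, q, ϱ, hq, -, -, -, hq1, -⟩ := key j
    rw [← hq]; exact hq1
  · obtain ⟨p, a, B, q, ϱ, hq, hϱ, ha, hB, hq1, hsum, hLj, hGj, h, hinv⟩ := key j
    have hT := algBorderRank_le_of_isolated K hinv
    have hW := (algBorderRank_tail_le K a B a q).trans hT
    have hread := virtualSum_le_algBorderRank K a B hst ha hB hW
    rw [hGj s t] at hread
    rw [← hϱ]
    exact hread

end Summit.MatrixMultiplication.MatrixMultiplication.Theorems.FarEdgeDescentIsolatedChain

end
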